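import Summits.Ventures.PercRepro.C026HubParallel

/-!
# Theorem R (R0), the count: `Δ_CF(G + v_{a^k b^l}) = (2^k + 2^l − 1)·Δ_CF(G)` (p6, gen 14)

The slack of the parallel hub `G.hubPar v a b k l` (`C026HubParallel`) is the sum over the `2^{k+l}` hub
states `σ` of the slice at `σ` (`slackCF_hubPar_eq_sum`, through `card_filter_sumElim`); the slice is
`Δ_CF(G)` when at most one class has an open edge and `0` otherwise (`sliceCF_hubPar`, from
`sliceCF_of_reach` and `hubLike_hubPar`); the states with at most one open class number
`2^k + 2^l − 1` (`card_not_both`).  Hence **`slackCF_hubPar`** — mine-3's (R0) (INBOX 6152); `k = l = 1`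
recovers Theorem H (H1), `l = 0` the pendant class `2^k`.
-/

namespace PercRepro

open Finset

namespace MultiGraph

section HubParSum

variable {V E : Type*} [Fintype E] {G : MultiGraph V E}

/-- A count over the configurations of `E ⊕ F` is the sum over the states of `F` of the counts over `E`
(stated for arbitrary `Fintype` instances on the configuration spaces, so that it rewrites the classical
counts of `slackCF`). -/
theorem card_filter_sumElim {E F : Type*} [Fintype (Config E)] [Fintype (Config F)]
    [Fintype (Config (E ⊕ F))] (Q : Config (E ⊕ F) → Prop) [DecidablePred Q] :
    (univ.filter Q).card =
      ∑ σ : Config F, (univ.filter fun ω : Config E => Q (Sum.elim ω σ)).card := by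
  rw [Finset.card_filter]
  rw [← Fintype.sum_equiv (Equiv.sumArrowEquivProdArrow E F Bool).symm
    (fun p => if Q ((Equiv.sumArrowEquivProdArrow E F Bool).symm p) then 1 else 0)
    (fun τ => if Q τ then 1 else 0) (fun _ => rfl), Fintype.sum_prod_type, Finset.sum_comm]
  refine Finset.sum_congr rfl fun σ _ => ?_
  rw [Finset.card_filter]
  rfl

open Classical in
/-- **`Δ_CF` of the parallel hub is the sum of its state slices.** -/
theorem slackCF_hubPar_eq_sum (v a b c : V) (k l : ℕ) :
    (G.hubPar v a b k l).slackCF a b c =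
      ∑ σ : Config (Fin k ⊕ Fin l),
        (G.hubPar v a b k l).sliceCF (fun ω : Config E => Sum.elim ω σ) a b c := by
  unfold slackCF sliceCF
  simp only [card_filter_sumElim]
  push_cast
  rw [Finset.sum_sub_distrib, Finset.sum_add_distrib, Finset.sum_add_distrib]

omit [Fintype E] in
/-- Transport of the hub invariant along an equivalent reach. -/
theorem HubLike.congr {E' : Type*} {H : MultiGraph V E'} {v : V} {ω : Config E} {τ : Config E'}
    {R R' : V → Prop} (h : HubLike G v H ω τ R) (hR : ∀ x, R x ↔ R' x) : HubLike G v H ω τ R' where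
  conn_iff x y hx hy := by rw [h.conn_iff x y hx hy, hR x, hR y]
  conn_v_iff x hx := by rw [h.conn_v_iff x hx, hR x]

omit [Fintype E] in
/-- The reach of a state, through its two Booleans. -/
theorem parReach_iff {k l : ℕ} (ω : Config E) (σ : Config (Fin k ⊕ Fin l)) (a b x : V) :
    G.parReach ω σ a b x ↔
      ((decide (∃ i, σ (Sum.inl i) = true)) = true ∧ G.Conn ω x a) ∨
        ((decide (∃ j, σ (Sum.inr j) = true)) = true ∧ G.Conn ω x b) := by
  unfold parReach
  simp only [decide_eq_true_iff, exists_and_right]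

open Classical in
/-- **The slice of the parallel hub at the state `σ`**: `0` if both classes have an open edge, `Δ_CF(G)`
otherwise. -/
theorem sliceCF_hubPar {v a b c : V} {k l : ℕ} (hv : G.Isolated v) (hav : a ≠ v) (hbv : b ≠ v)
    (hcv : c ≠ v) (σ : Config (Fin k ⊕ Fin l)) :
    (G.hubPar v a b k l).sliceCF (fun ω : Config E => Sum.elim ω σ) a b c =
      if (∃ i, σ (Sum.inl i) = true) ∧ (∃ j, σ (Sum.inr j) = true) then 0 else G.slackCF a b c := by
  have key := sliceCF_of_reach (H := G.hubPar v a b k l) (f := fun ω : Config E => Sum.elim ω σ)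
    hav hbv hcv (decide (∃ i, σ (Sum.inl i) = true)) (decide (∃ j, σ (Sum.inr j) = true))
    (decide (∃ i, σᶜ (Sum.inl i) = true)) (decide (∃ j, σᶜ (Sum.inr j) = true))
    (fun ω => (hubLike_hubPar hv hav hbv ω σ).congr (parReach_iff ω σ a b))
    (fun ω => by
      rw [compl_sumElim]
      exact (hubLike_hubPar hv hav hbv ωᶜ σᶜ).congr (parReach_iff ωᶜ σᶜ a b))
  rw [key]
  simp only [decide_eq_true_iff]

open Classical in
/-- The states of `Fin k` with an open edge: `2^k − 1`. -/
theorem card_exists_true (k : ℕ) :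
    ((univ.filter fun σ : Config (Fin k) => ∃ i, σ i = true).card : ℤ) = 2 ^ k - 1 := by
  have h := Finset.card_filter_add_card_filter_not (s := (univ : Finset (Config (Fin k))))
    (fun σ : Config (Fin k) => ∃ i, σ i = true)
  have h1 : (univ.filter fun σ : Config (Fin k) => ¬ ∃ i, σ i = true) = {fun _ => false} := by
    ext σ
    simp only [Finset.mem_filter, Finset.mem_univ, true_and, Finset.mem_singleton, not_exists,
      Bool.not_eq_true]
    constructor
    · intro hσ
      funext i
      exact hσ i
    · intro hσ i
      rw [hσ]
  rw [h1, Finset.card_singleton, Finset.card_univ, Fintype.card_fun, Fintype.card_bool,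
    Fintype.card_fin] at h
  have h2 : ((univ.filter fun σ : Config (Fin k) => ∃ i, σ i = true).card : ℤ) + 1 = 2 ^ k := by
    exact_mod_cast h
  linarith

open Classical in
/-- The states of `Fin k ⊕ Fin l` with an open edge in BOTH classes: `(2^k − 1)(2^l − 1)`. -/
theorem card_both (k l : ℕ) :
    ((univ.filter fun σ : Config (Fin k ⊕ Fin l) =>
      (∃ i, σ (Sum.inl i) = true) ∧ (∃ j, σ (Sum.inr j) = true)).card : ℤ) =
      (2 ^ k - 1) * (2 ^ l - 1) := by
  simp only [card_filter_sumElim]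
  push_cast
  have h : ∀ σ : Config (Fin l), ((univ.filter fun ω : Config (Fin k) =>
      (∃ i, Sum.elim ω σ (Sum.inl i) = true) ∧ (∃ j, Sum.elim ω σ (Sum.inr j) = true)).card : ℤ) =
      if (∃ j, σ j = true) then ((univ.filter fun ω : Config (Fin k) => ∃ i, ω i = true).card : ℤ)
        else 0 := by
    intro σ
    simp only [Sum.elim_inl, Sum.elim_inr]
    split_ifs with hσ
    · congr 2
      ext ω
      simp only [Finset.mem_filter, Finset.mem_univ, true_and, hσ, and_true]
    · simp only [hσ, and_false, Finset.filter_false, Finset.card_empty, Nat.cast_zero]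
  simp only [h]
  rw [Finset.sum_ite, Finset.sum_const_zero, add_zero, Finset.sum_const, nsmul_eq_mul,
    card_exists_true l, card_exists_true k]
  ring

open Classical in
/-- The states with at most one open class: `2^k + 2^l − 1`. -/
theorem card_not_both (k l : ℕ) :
    ((univ.filter fun σ : Config (Fin k ⊕ Fin l) =>
      ¬ ((∃ i, σ (Sum.inl i) = true) ∧ (∃ j, σ (Sum.inr j) = true))).card : ℤ) =
      2 ^ k + 2 ^ l - 1 := by
  have h := Finset.card_filter_add_card_filter_not (s := (univ : Finset (Config (Fin k ⊕ Fin l))))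
    (fun σ : Config (Fin k ⊕ Fin l) => (∃ i, σ (Sum.inl i) = true) ∧ (∃ j, σ (Sum.inr j) = true))
  rw [Finset.card_univ, Fintype.card_fun, Fintype.card_bool, Fintype.card_sum, Fintype.card_fin,
    Fintype.card_fin] at h
  have h2 := card_both k l
  have h3 : ((univ.filter fun σ : Config (Fin k ⊕ Fin l) =>
      (∃ i, σ (Sum.inl i) = true) ∧ (∃ j, σ (Sum.inr j) = true)).card : ℤ) +
      ((univ.filter fun σ : Config (Fin k ⊕ Fin l) =>
        ¬ ((∃ i, σ (Sum.inl i) = true) ∧ (∃ j, σ (Sum.inr j) = true))).card : ℤ) = 2 ^ (k + l) := by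
    exact_mod_cast h
  rw [pow_add] at h3
  linarith

open Classical in
/-- **Theorem R (R0)** (mine-3, INBOX 6152): a vertex `v` joined to `a` by `k` edges and to `b` by `l`
edges, and to nothing else, multiplies the C-026 slack by `2^k + 2^l − 1`:
`Δ_CF(G + v_{a^k b^l}) = (2^k + 2^l − 1)·Δ_CF(G)`. -/
theorem slackCF_hubPar {v a b c : V} (hv : G.Isolated v) (hav : a ≠ v) (hbv : b ≠ v) (hcv : c ≠ v)
    (k l : ℕ) :
    (G.hubPar v a b k l).slackCF a b c = (2 ^ k + 2 ^ l - 1) * G.slackCF a b c := by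
  rw [slackCF_hubPar_eq_sum]
  simp only [sliceCF_hubPar hv hav hbv hcv]
  rw [Finset.sum_ite, Finset.sum_const_zero, zero_add, Finset.sum_const, nsmul_eq_mul,
    card_not_both]

/-- (R0) at `k = l = 1` is the factor `3` of Theorem H (H1). -/
theorem slackCF_hubPar_one_one {v a b c : V} (hv : G.Isolated v) (hav : a ≠ v) (hbv : b ≠ v)
    (hcv : c ≠ v) : (G.hubPar v a b 1 1).slackCF a b c = 3 * G.slackCF a b c := by
  rw [slackCF_hubPar hv hav hbv hcv]
  norm_num

/-- (R0) at `l = 0` is the pendant class: `2^k` (a leaf in every state). -/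
theorem slackCF_hubPar_pendant {v a b c : V} (hv : G.Isolated v) (hav : a ≠ v) (hbv : b ≠ v)
    (hcv : c ≠ v) (k : ℕ) : (G.hubPar v a b k 0).slackCF a b c = 2 ^ k * G.slackCF a b c := by
  rw [slackCF_hubPar hv hav hbv hcv]
  ring

end HubParSum

end MultiGraph

end PercRepro
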